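import Summits.Ventures.PercRepro.C025ProfilePLDUniformTable_r6_s3_m5
import Summits.Ventures.PercRepro.C025ProfilePLDPlaneLiftArith
import Summits.Ventures.PercRepro.C025ProfilePLDPlaneTable6

/-!
# (PLD) FOR «M ⊕ U_{3,m}» FOR EVERY m ≥ 5 AND EVERY (PLD)-MATROID M OF RANK ≤ 6: THE CERTIFICATE TABLE FOR U_{3,5} LIFTED IN m (night-3 g31)

`proofs/NIGHT3-G31-TWOLIFT.md` §5.  The profile of the plane `U_{3,m}` is `T₀₃ + m·T₁₃ + C(m,2)·T₂₃ + c_m·δ₃₃`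
(`PLDPlaneLift.sum_choose_min_three`, `m ≥ 5`); `T₂₃` and `δ₃₃` preserve PER-LAYER DOMINANCE (g29) and `q = 2·T₁₃ + 8·T₂₃`
does at rank ≤ 6 (`PLDPlaneTable.pld_conv_q3b4_of_eRank_le_6`), and `2·(U_{3,m} − U_{3,m₀}) = (m−m₀)·q + (m−m₀)(m+m₀−9)·T₂₃ +
2(c_m − c_{m₀})·δ₃₃` for `5 ≤ m₀ ≤ m` (`lift_instance_plane`): ONE certificate table — the landed `uniform_3_5_table_6` for
`M ⊕ U_{3,5}` at rank ≤ 6 — gives (PLD) for `M ⊕ U_{3,m}` for EVERY `m ≥ 5`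
(`pld_disjointSum_uniform_three_ge_5_of_eRank_le_6`).  No `def`, no `instance`, no notation.  Axioms: standard.
-/

open scoped Matroid

namespace PercRepro

open Finset ThmH

namespace PLDPlaneLift

variable {α : Type} [DecidableEq α]

/-- (PLD) FOR «M ⊕ U_{3,m}» FOR EVERY `m ≥ 5` AND EVERY (PLD)-MATROID `M` OF RANK ≤ 6: the uniform matroid is
`truncate (freeOn F) 3` with `|F| = m ≥ 5`. -/
theorem pld_disjointSum_uniform_three_ge_5_of_eRank_le_6 (M : Matroid α) [M.Finite] (hr : M.eRank ≤ 6)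
    (hPLD : ∀ lo hi δ Θ : ℕ, Θ ≤ lo + hi + δ → (lo = 0 ∨ lo + hi + δ ≤ Θ) →
      (∑ I ∈ (gr M).powerset, (if lo ≤ (M.eRk (I : Set α)).toNat ∧ (M.eRk (I : Set α)).toNat ≤ hi ∧
          Θ ≤ (M.eRk ((gr M \ I : Finset α) : Set α)).toNat + (M.eRk (I : Set α)).toNat then
          ((M.eRk ((gr M \ I : Finset α) : Set α)).toNat).choose δ else 0)) ≤
        ∑ I ∈ (gr M).powerset, (if lo + δ ≤ (M.eRk ((gr M \ I : Finset α) : Set α)).toNat ∧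
          (M.eRk ((gr M \ I : Finset α) : Set α)).toNat ≤ hi + δ then
          ((M.eRk ((gr M \ I : Finset α) : Set α)).toNat).choose δ else 0))
    (F : Finset α) (hF : 5 ≤ F.card)
    (h : Disjoint M.E (@Matroid.truncate α (Matroid.freeOn (F : Set α)) (PLDTruncate.freeOn_finite' F) 3).E) :
    haveI := PLDTruncate.freeOn_finite' F
    haveI := PLDClosure.disjointSum_finite' _ _ h
    ∀ lo hi δ Θ : ℕ, Θ ≤ lo + hi + δ → (lo = 0 ∨ lo + hi + δ ≤ Θ) →
      (∑ I ∈ (gr (M.disjointSum (Matroid.truncate (Matroid.freeOn (F : Set α)) 3) h)).powerset, (if lo ≤ ((M.disjointSum (Matroid.truncate (Matroid.freeOn (F : Set α)) 3) h).eRk (I : Set α)).toNat ∧ ((M.disjointSum (Matroid.truncate (Matroid.freeOn (F : Set α)) 3) h).eRk (I : Set α)).toNat ≤ hi ∧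
          Θ ≤ ((M.disjointSum (Matroid.truncate (Matroid.freeOn (F : Set α)) 3) h).eRk ((gr (M.disjointSum (Matroid.truncate (Matroid.freeOn (F : Set α)) 3) h) \ I : Finset α) : Set α)).toNat + ((M.disjointSum (Matroid.truncate (Matroid.freeOn (F : Set α)) 3) h).eRk (I : Set α)).toNat then
          (((M.disjointSum (Matroid.truncate (Matroid.freeOn (F : Set α)) 3) h).eRk ((gr (M.disjointSum (Matroid.truncate (Matroid.freeOn (F : Set α)) 3) h) \ I : Finset α) : Set α)).toNat).choose δ else 0)) ≤
        ∑ I ∈ (gr (M.disjointSum (Matroid.truncate (Matroid.freeOn (F : Set α)) 3) h)).powerset, (if lo + δ ≤ ((M.disjointSum (Matroid.truncate (Matroid.freeOn (F : Set α)) 3) h).eRk ((gr (M.disjointSum (Matroid.truncate (Matroid.freeOn (F : Set α)) 3) h) \ I : Finset α) : Set α)).toNat ∧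
          ((M.disjointSum (Matroid.truncate (Matroid.freeOn (F : Set α)) 3) h).eRk ((gr (M.disjointSum (Matroid.truncate (Matroid.freeOn (F : Set α)) 3) h) \ I : Finset α) : Set α)).toNat ≤ hi + δ then
          (((M.disjointSum (Matroid.truncate (Matroid.freeOn (F : Set α)) 3) h).eRk ((gr (M.disjointSum (Matroid.truncate (Matroid.freeOn (F : Set α)) 3) h) \ I : Finset α) : Set α)).toNat).choose δ else 0) := by
  haveI := PLDTruncate.freeOn_finite' F
  haveI := PLDClosure.disjointSum_finite' _ _ h
  have hU : (Matroid.truncate (Matroid.freeOn (F : Set α)) 3).eRank ≤ ((3 : ℕ) : ℕ∞) := by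
    rw [Matroid.truncate_eRank]; exact min_le_right _ _
  have hr' : M.eRank ≤ ((6 : ℕ) : ℕ∞) := by exact_mod_cast hr
  have hb : ∀ I ∈ (gr (M.disjointSum (Matroid.truncate (Matroid.freeOn (F : Set α)) 3) h)).powerset,
      ((M.disjointSum (Matroid.truncate (Matroid.freeOn (F : Set α)) 3) h).eRk (I : Set α)).toNat ≤ 9 ∧ ((M.disjointSum (Matroid.truncate (Matroid.freeOn (F : Set α)) 3) h).eRk ((gr (M.disjointSum (Matroid.truncate (Matroid.freeOn (F : Set α)) 3) h) \ I : Finset α) : Set α)).toNat ≤ 9 := by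
    intro I _
    constructor
    · rw [PLDClosure.toNat_eRk_disjointSum]
      have h1 := PLDCert.toNat_eRk_le_of_eRank_le M hr' ((I ∩ gr M : Finset α) : Set α)
      have h2 := PLDCert.toNat_eRk_le_of_eRank_le _ hU ((I ∩ gr (Matroid.truncate (Matroid.freeOn (F : Set α)) 3) : Finset α) : Set α)
      omega
    · rw [PLDClosure.toNat_eRk_disjointSum]
      have h1 := PLDCert.toNat_eRk_le_of_eRank_le M hr' (((gr (M.disjointSum (Matroid.truncate (Matroid.freeOn (F : Set α)) 3) h) \ I) ∩ gr M : Finset α) : Set α)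
      have h2 := PLDCert.toNat_eRk_le_of_eRank_le _ hU (((gr (M.disjointSum (Matroid.truncate (Matroid.freeOn (F : Set α)) 3) h) \ I) ∩ gr (Matroid.truncate (Matroid.freeOn (F : Set α)) 3) : Finset α) : Set α)
      omega
  refine PLDSymCex.pld_of_bounded (gr (M.disjointSum (Matroid.truncate (Matroid.freeOn (F : Set α)) 3) h)).powerset (fun I : Finset α => ((M.disjointSum (Matroid.truncate (Matroid.freeOn (F : Set α)) 3) h).eRk (I : Set α)).toNat)
    (fun I : Finset α => ((M.disjointSum (Matroid.truncate (Matroid.freeOn (F : Set α)) 3) h).eRk ((gr (M.disjointSum (Matroid.truncate (Matroid.freeOn (F : Set α)) 3) h) \ I : Finset α) : Set α)).toNat) 9 hb ?_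
  intro lo hi δ hlh hhR hδR
  have hL := PLDClosure.sum_powerset_disjointSum M _ h
    (fun x f => if lo ≤ x ∧ x ≤ hi ∧ (if lo = 0 then 0 else lo + hi + δ) ≤ f + x then f.choose δ else 0)
  have hR := PLDClosure.sum_powerset_disjointSum M _ h
    (fun x f => if lo + δ ≤ f ∧ f ≤ hi + δ then f.choose δ else 0)
  beta_reduce at hL hR
  rw [hL, hR]
  have h2L : ∀ x₁ f₁ : ℕ,
      ∑ I₂ ∈ (gr (Matroid.truncate (Matroid.freeOn (F : Set α)) 3)).powerset,
        (if lo ≤ x₁ + ((Matroid.truncate (Matroid.freeOn (F : Set α)) 3).eRk (I₂ : Set α)).toNat ∧ x₁ + ((Matroid.truncate (Matroid.freeOn (F : Set α)) 3).eRk (I₂ : Set α)).toNat ≤ hi ∧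
            (if lo = 0 then 0 else lo + hi + δ) ≤ f₁ + ((Matroid.truncate (Matroid.freeOn (F : Set α)) 3).eRk ((gr (Matroid.truncate (Matroid.freeOn (F : Set α)) 3) \ I₂ : Finset α) : Set α)).toNat +
              (x₁ + ((Matroid.truncate (Matroid.freeOn (F : Set α)) 3).eRk (I₂ : Set α)).toNat) then
          (f₁ + ((Matroid.truncate (Matroid.freeOn (F : Set α)) 3).eRk ((gr (Matroid.truncate (Matroid.freeOn (F : Set α)) 3) \ I₂ : Finset α) : Set α)).toNat).choose δ else 0) =
      (∑ i ∈ range (F.card + 1), Nat.choose F.card i * (if lo ≤ x₁ + min i 3 ∧ x₁ + min i 3 ≤ hi ∧ (if lo = 0 then 0 else lo + hi + δ) ≤ (f₁ + min (F.card - i) 3) + (x₁ + min i 3) then (f₁ + min (F.card - i) 3).choose δ else 0)) := by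
    intro x₁ f₁
    have := PLDTruncate.sum_powerset_truncate_freeOn F 3
      (fun x₂ f₂ => if lo ≤ x₁ + x₂ ∧ x₁ + x₂ ≤ hi ∧ (if lo = 0 then 0 else lo + hi + δ) ≤ f₁ + f₂ + (x₁ + x₂) then
        (f₁ + f₂).choose δ else 0)
    beta_reduce at this
    exact this
  have h2R : ∀ f₁ : ℕ,
      ∑ I₂ ∈ (gr (Matroid.truncate (Matroid.freeOn (F : Set α)) 3)).powerset,
        (if lo + δ ≤ f₁ + ((Matroid.truncate (Matroid.freeOn (F : Set α)) 3).eRk ((gr (Matroid.truncate (Matroid.freeOn (F : Set α)) 3) \ I₂ : Finset α) : Set α)).toNat ∧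
            f₁ + ((Matroid.truncate (Matroid.freeOn (F : Set α)) 3).eRk ((gr (Matroid.truncate (Matroid.freeOn (F : Set α)) 3) \ I₂ : Finset α) : Set α)).toNat ≤ hi + δ then
          (f₁ + ((Matroid.truncate (Matroid.freeOn (F : Set α)) 3).eRk ((gr (Matroid.truncate (Matroid.freeOn (F : Set α)) 3) \ I₂ : Finset α) : Set α)).toNat).choose δ else 0) =
      (∑ i ∈ range (F.card + 1), Nat.choose F.card i * (if lo + δ ≤ f₁ + min (F.card - i) 3 ∧ f₁ + min (F.card - i) 3 ≤ hi + δ then (f₁ + min (F.card - i) 3).choose δ else 0)) := by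
    intro f₁
    have := PLDTruncate.sum_powerset_truncate_freeOn F 3
      (fun x₂ f₂ => if lo + δ ≤ f₁ + f₂ ∧ f₁ + f₂ ≤ hi + δ then (f₁ + f₂).choose δ else 0)
    beta_reduce at this
    exact this
  simp only [h2L, h2R]
  -- the case `m = 5` from the landed table
  obtain ⟨hDpos, hadm, hcert⟩ := PLDTriangle.uniform_3_5_table_6 lo (mem_range.2 (by omega)) hi (mem_range.2 (by omega))
    δ (mem_range.2 (by omega)) hlh
  have key := PLDCert.sum_le_of_cert M hPLD 6 hr' _ hadm _ _ hcert
  rw [← Finset.mul_sum, ← Finset.mul_sum] at key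
  have h4 := Nat.le_of_mul_le_mul_left key hDpos
  -- the lift to `m = |F| ≥ 5`
  have hq := PLDPlaneTable.pld_conv_q3b4_of_eRank_le_6 M hr hPLD lo hi δ hlh hhR hδR
  exact lift_instance_plane (gr M).powerset (fun I : Finset α => (M.eRk (I : Set α)).toNat)
    (fun I : Finset α => (M.eRk ((gr M \ I : Finset α) : Set α)).toNat) hPLD 5 F.card (by omega) hF lo hi δ
    (if lo = 0 then 0 else lo + hi + δ) (by split_ifs <;> omega) (by split_ifs <;> omega) hq h4

end PLDPlaneLift

end PercRepro
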